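import Literature.Barriers.PneNP.RelativizedCircuitSizeHolds
import Literature.Barriers.PneNP.RelativizationSparseProofs
import HarnessLib

/-!
# Barrier catalogue `PneNP`: relativized circuit size — which oracles and which oracle gates carry
Wilson's barrier (D-0021 barrier audit of `RelativizedCircuitSize`, 2026-08-16)

Outcome of the refuter's audit of `Literature.Barriers.PneNP.RelativizedCircuitSize` (Wilson,
*Relativized circuit complexity*, JCSS 31 (1985), Thms. 3.1 and 4). The formal content of that
entry is CONFIRMED — the barrier fact is even a theorem of the tree
(`RelativizedCircuitSize_holds`, `RelativizedCircuitSizeHolds.lean`), every no-go reading is proved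
from it, and the page-level quotations (pp. 170, 171–172, 173–175, 176–177, 180) were re-read. Its
prose scope (`technique_class: relativizing, relativization, diagonalization, simulation,
oracle-circuits, …, b2-circuits`; `blocks: relativizing proofs … of any superlinear circuit-size
lower bound for a language in P, NP or Δ₂ᵖ`) is NARROWED, and this file is the formal counterpart
of the narrowing: it identifies WHICH oracles and WHICH oracle gates carry the barrier. It is the
circuit-size companion of `Literature.Barriers.PneNP.RelativizationSparse` (the 2026-08-14 audit
of Baker–Gill–Solovay), whose sparse/tally vocabulary (`IsSparseLanguage`, `IsTally`,
`CRelativizes`) it uses.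

1. **Tally oracles carry no barrier at all** (§ Tally). In Wilson's model (`SIZERel A s`:
   circuits over `B₂ ∪ {A_m}`, an `A_m`-gate charged its fan-in `m`, §2 p. 172) an oracle gate of
   a TALLY language `T ⊆ 0*` is the gate `NOR_m` (if `0^m ∈ T`) or a constant — a `B₂`-circuit of
   at most its own charged cost (`IsTally.cktSize_oracleGate`). By a gate-by-gate simulation
   (`Circuit.cktSize_eval_of_gadgets`, Vollmer's Lemma 1.36 pattern, size only) therefore
   `SIZE^T(s) ⊆ SIZE(s + 1)` (`IsTally.SIZERel_subset_SIZE`), `⋃_c SIZE^T(c·n + c) = ⋃_c SIZE(c·n + c)`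
   and likewise for `c·n^k + c`. Consequently, for any relativized class `A ↦ 𝒞^A` with
   `𝒞^∅ = C₀ ⊆ 𝒞^A` — instances `NP`, `P`, `Δ₂ᵖ = P^{NP}` — each of the three lower-bound
   shapes "some language of `𝒞^T` has no `T`-oracle circuits of linear / of every fixed-polynomial
   / of polynomial size" holds for ALL tally `T` IFF the unrelativized lower bound holds
   (`tally_superlinear_iff`, `tally_fixedPoly_iff`, `tally_superpoly_iff`; `np_…`, `p_…`,
   `deltaTwo_…`): the circuit-size analogue of Long–Selman's `P = NP ↔ ∀ tally T, P^T = NP^T`,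
   here an outright (and easy) theorem because `∅` is tally and tally gates are `B₂`-gates.
2. **Sparse oracles carry the barrier only if `NP ⊆ P/poly`** (§ Sparse). An oracle gate of a
   language of census `≤ m^a + a` is a disjunction of word tests of `B₂`-size
   `≤ (m^a + a)(2m + 1) + m^a + a + 1` (`cktSize_sliceFn_of_ncard_le`, the one-slice form of the
   tree's `mem_PPoly_of_isSparseLanguage`, Schöning §4 / Berman–Hartmanis–Meyer), so
   `SIZE^S(s) ⊆ SIZE(s·G_a(s) + 1)` (`SIZERel_subset_SIZE_of_census`) and
   `⋃_{k,c} SIZE^S(c·n^k + c) ⊆ P/poly` (`IsSparseLanguage.SIZERel_pow_subset_PPoly`). Hence a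
   SPARSE oracle with the conclusion of Wilson's Thm. 3.1 — `Δ₂^{P,S}`, or just `NP^S`, inside
   `⋃_c SIZE^S(c·n + c)` — would prove `NP ⊆ P/poly` (`NP_subset_PPoly_of_sparse_np_linear`,
   `NP_subset_PPoly_of_sparse_deltaTwo_linear`); unless `NP ⊆ P/poly` (i.e. unless the thesis of
   route PneNP/Circuit is false) every lower-bound shape for `NP` holds relative to EVERY sparse
   oracle (`np_sparse_superpoly`, `cRelativizes_sparse_of_NP_not_subset_PPoly`), and Wilson's `B`
   is dense (`not_isSparseLanguage_of_deltaTwo_linear`, `wilson_oracle_dense`). (Lemma 2's `B`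
   answers one query `⟨i,x⟩α_N` per machine `i` and input `x`, pp. 173–175: `2^{Ω(m)}` words of
   each length `m`.)
3. **Oracle gates of logarithmic fan-in carry no barrier, whatever the oracle** (§ Fan-in). For
   the sub-model `SIZERelFanIn A K s` of `A`-oracle circuits whose oracle gates have fan-in
   `≤ K(n)` (Wilson's own Thm. 0, p. 172, and the FACT of Thm. 4, p. 176, are parametrised by the
   query length) an oracle gate is a Shannon-expansion circuit of `≤ 5·2^{K(n)}` gates
   (`cktSize_univ_fin`), so `SIZE^A_{≤K}(s) ⊆ SIZE(s·univBound(K) + 1)` (`SIZERelFanIn_subset_SIZE`)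
   and, if `2^{K(n)} ≤ poly(n)`, a linear-size collapse of `NP^A` in this model proves
   `NP ⊆ P/poly` for ANY `A` (`NP_subset_PPoly_of_fanIn_np_linear`). Wilson's circuit is ONE
   oracle gate of fan-in `2n + o(n)` (Lemma 2, Fig. 1; p. 175: size `n + |α| = log T + n + 3 + n`):
   the barrier lives entirely in oracle gates at least as wide as (a constant fraction of) the
   input. Whether fan-in between `ω(log n)` and `n` admits a contrary oracle is not known to us
   (prose; no claim is recorded).
4. **Prose narrowing, no formal change** (recorded in the `RelativizedCircuitSizeNarrow` block):
   (d) the barrier concerns NON-UNIFORM circuits — `∀ k, P ⊄ P-uniform SIZE(n^k)` and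
   `NP ⊄ P^{NP}_{||}-uniform SIZE(n^k)` are theorems by diagonalization (Santhanam–Williams 2014,
   Thms. 1.1 and 1.3), Wilson's circuits hard-wiring the non-uniform stage strings `α_N`;
   (e) `diagonalization, simulation, b2-circuits, circuit-lower-bounds` in the technique class are
   covered ONLY insofar as the whole argument relativizes with unbounded-fan-in oracle gates —
   gate elimination (Blum's `3n > 2n + o(n)`, Wilson p. 175), restriction / formula / depth
   arguments and SAT-algorithm-based diagonalization (Williams) do not, trivially, against one gate
   of fan-in `2n`; Fortnow: "Although one can easily relativize circuits [Wil85], many researchers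
   believed the structure of circuits would allow us to find nonrelativizable techniques" (1994,
   §3.3). Aaronson (2006, §1 and §1.3) places the "relativization barrier" for superlinear size
   below `BPP^{NP}_{||}` and `PP`, above Wilson's `P^{NP}` — consistent with the entry.
5. No literature contradicting the barrier fact was found (searches: `lit galaxy` over books,
   papers and web for "relativized circuit complexity", oracle gates / positive relativization /
   fixed-polynomial lower bounds; the local `lit search` index and OpenAlex/S2 were unavailable
   (rc 1 / HTTP 429) during the audit, recorded in the refuter's notes). `RelativizedCircuitSizeNarrow`
   re-records the barrier with the three riders (all theorems: `RelativizedCircuitSizeNarrow_holds`).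

**Conventions.** `SIZERel`, `oracleGates`, `oracleGateCost`, `oracleSize` (`Algebrization.lean`);
`DeltaTwoRel`, `Wilson1985_thm_3_1/4`, `RelativizedCircuitSize` (`RelativizedCircuitSize.lean`);
`IsTally`, `IsSparseLanguage`, `CRelativizes`, `NP_subset_NPRel` (`RelativizationSparse.lean`,
`MCSPHardnessObstructions.lean`, `BoundedRelativization.lean`); `CktSize` calculus
(`CircuitComposition.lean`), `cktSize_forall_eq_const` (`RelativizationSparseProofs.lean`),
`cktSize_anyFin` (`PolyAdvicePH.lean`). The fixed-polynomial and polynomial classes are rendered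
`⋃_c SIZE(c·n^k + c)` (robust to the one constant gate of the simulations); `P/poly` membership is
bridged by `not_mem_PPoly_iff`. New definitions: `sparseGadgetBound`, `oracleGatesLe`,
`SIZERelFanIn`, `RelativizedCircuitSizeNarrow` (proved). Everything in this file is proved; no
named facts are introduced.

## Sources (locators verified with `lit read` / `lit galaxy read`)

* C. B. Wilson, *Relativized circuit complexity*, J. Comput. Syst. Sci. 31 (1985) 169–181
  [Wilson1985] (held; PDF p. = journal p. − 168): §1.2 (a)–(c) (p. 170), §2 (model, pp. 171–172),
  Thm. 0 (p. 172: relativized Lupanov bound "if questions to `A` of size no greater than `p` are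
  allowed"), Prop. 1 (p. 172), Lemma 2 with proof and Fig. 1 (pp. 173–175), Thms. 3.1–3.3 and the
  discussion of Kannan / Karp–Lipton / Blum (p. 175), FACT and Thm. 4 (pp. 176–177), §4 (p. 180).
* U. Schöning, *Complexity theory and interaction* (1995) [Schoning1995] (held): §3 (p. 527),
  §4 Theorem (Karp–Lipton; Berman–Hartmanis) and proof of (c) → (a) (pp. 528–529) — through
  `RelativizationSparse(Proofs).lean`. J. Kadin, JCSS 39 (1989) [Kadin1989], §1 (p. 286).
  T. Long, A. Selman, J. ACM 33 (1986) [LongSelman1986], abstract (not held; as in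
  `RelativizationSparse.lean`).
* S. Aaronson, *Oracles are subtle but not malicious*, CCC 2006, arXiv cs/0504048 [Aaronson2006]
  (held): abstract, §1 (arXiv p. 3: "Wilson gave relativized worlds where NP and P^NP have
  linear-size circuits"), §1.3 (the "battle map": relativization barrier below `BPP^{NP}_{||}`,
  `PP`), §4 remark (1).
* R. Santhanam, R. Williams, *On uniformity and circuit lower bounds*, Comput. Complexity 23
  (2014) 177–205 [SanthanamWilliams2014] (read: accepted version, `lit galaxy`): Thm. 1.1
  (`∀ k, P ⊄ P-uniform SIZE(n^k)`), Thm. 1.3 (`∀ k, NP ⊄ P^{NP}_{||}-uniform SIZE(n^k)`).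
* L. Fortnow, *The role of relativization in complexity theory*, Bull. EATCS 52 (1994)
  [Fortnow1994] (held, author's version): §3.3 (p. 4), quoted in 4.
* S. Hirahara, Z. Lu, H. Ren, *Bounded relativization*, CCC 2023 [HiraharaLuRen2023], §1.1 —
  through `BoundedRelativization.lean` (`CRelativizes`).
* H. Vollmer, *Introduction to Circuit Complexity* (1999) [Vollmer1999], §1.1–1.2, §1.4
  Lemma 1.36 (replacing oracle gates by circuits); S. Arora, B. Barak, *Computational Complexity*
  (2009) [AroraBarakCC2009], Claim 2.13 (every function has a circuit), Def. 6.5 (`P/poly`).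
-/

namespace Literature.Barriers.PneNP

open _root_.Computability Literature.Computability.Complexity Literature.Computability.Complexity.Classes
  Literature.Computability.Complexity.Nondeterministic GateList Polynomial

/-! ### Gate-by-gate elimination of a basis (size only) -/

section Gadgets

variable {ι : Type*} {B : Set GateFn} (w : GateFn → ℕ)

/-- **All wires of a program over `B` as one multi-output map over `B₂`**, given for every gate
function `g ∈ B` a `B₂`-program ("gadget") computing it with at most `w g` gates: the program
`gl` is simulated gate by gate, gate `j` being replaced by its gadget re-wired to the wires that
carry the values gate `j` reads; the values of ALL wires `ι ⊕ ℕ` of `gl` (inputs, gates, and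
`false` beyond the last gate) are realized with `Σ_j w(g_j) + 1` gates (one constant gate for the
out-of-range wires). [cite: Vollmer1999, §1.4 Lemma 1.36 (replacing oracle gates by circuits)] -/
theorem GateList.cktSize_wires_of_gadgets
    (hg : ∀ g ∈ B, CktSize B2 (fun (z : Fin g.1 → Bool) (_ : Unit) => g.2 z) (w g))
    (gl : List (Gate ι)) (hB : ∀ g ∈ gl, g.fn ∈ B) :
    CktSize B2 (fun (x : ι → Bool) (u : ι ⊕ ℕ) => wireOf x (vals gl x) u)
      ((gl.map fun g => w g.fn).sum + 1) := by
  induction gl using List.reverseRecOn with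
  | nil =>
    have h0 : CktSize B2 (fun (x : ι → Bool) => Sum.elim x (fun _ : Unit => false)) (0 + 1) :=
      (CktSize.id B2).pair (cktSize_const ι false)
    refine ((h0.outMap (Sum.elim (fun i => Sum.inl i) (fun _ => Sum.inr ()))).of_le
      (by simp)).congr ?_
    rintro x (i | m)
    · rfl
    · simp
  | append_singleton gl g ih =>
    have hBg : g.fn ∈ B := hB g (by simp)
    have ih' := ih fun g' hg' => hB g' (List.mem_append_left _ hg')
    -- the gadget of `g`, rewired along its argument wires
    have hgad : CktSize B2 (fun (y : ι ⊕ ℕ → Bool) (_ : Unit) => g.op fun a => y (g.args a))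
        (w g.fn) :=
      (hg g.fn hBg).rewire g.args
    have hG : CktSize B2 (fun (y : ι ⊕ ℕ → Bool) =>
        Sum.elim y (fun _ : Unit => g.op fun a => y (g.args a))) (0 + w g.fn) :=
      (CktSize.id B2).pair hgad
    -- the new gate goes to position `gl.length`; every other wire keeps its value
    have hcomp := ih'.comp (hG.outMap (Sum.elim (fun i => Sum.inl (Sum.inl i))
      (fun m => if m = gl.length then Sum.inr () else Sum.inl (Sum.inr m))))
    refine (hcomp.of_le ?_).congr ?_
    · simp only [List.map_append, List.map_cons, List.map_nil, List.sum_append, List.sum_cons,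
        List.sum_nil]
      omega
    · rintro x (i | m)
      · rfl
      · simp only [Sum.elim_inr]
        by_cases hm : m = gl.length
        · subst hm
          rw [if_pos rfl, Sum.elim_inr, wireOf_inr, vals_append_singleton,
            List.getD_eq_getElem?_getD, List.getElem?_append_right (by simp), length_vals,
            Nat.sub_self]
          rfl
        · rw [if_neg hm, Sum.elim_inl, wireOf_inr, wireOf_inr, vals_append_singleton,
            List.getD_eq_getElem?_getD, List.getD_eq_getElem?_getD]
          rcases Nat.lt_or_gt_of_ne hm with hlt | hgt
          · rw [List.getElem?_append_left (by simpa using hlt)]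
          · rw [List.getElem?_eq_none (by simp; omega),
              List.getElem?_eq_none (by simp; omega)]

/-- **Gate-by-gate elimination of a basis**: a circuit over `B` is computed by a `B₂`-circuit
with at most `C.sizeWith w + 1 = Σ_g w(g) + 1` gates, given `B₂`-gadgets of sizes `w` for the
gate functions of `B` (Vollmer: replacing the oracle gates of a circuit by circuits computing
them multiplies the size by that of the gadgets). [cite: Vollmer1999, §1.4 Lemma 1.36] -/
theorem Circuit.cktSize_eval_of_gadgets
    (hg : ∀ g ∈ B, CktSize B2 (fun (z : Fin g.1 → Bool) (_ : Unit) => g.2 z) (w g))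
    (C : Circuit ι) (hC : C.IsOver B) :
    CktSize B2 (fun x (_ : Unit) => C.eval x) (C.sizeWith w + 1) := by
  refine ((GateList.cktSize_wires_of_gadgets w hg C.gates hC).outMap
    (fun _ : Unit => C.output)).congr fun x _ => ?_
  obtain ⟨gs, o, hwf, ho⟩ := C
  cases o <;> rfl

/-- Circuit form of `Circuit.cktSize_eval_of_gadgets`: an equivalent `B₂`-circuit of size
`≤ C.sizeWith w + 1`. [cite: Vollmer1999, §1.4 Lemma 1.36] -/
theorem Circuit.exists_B2_of_gadgets
    (hg : ∀ g ∈ B, CktSize B2 (fun (z : Fin g.1 → Bool) (_ : Unit) => g.2 z) (w g))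
    (C : Circuit ι) (hC : C.IsOver B) :
    ∃ C' : Circuit ι, C'.IsOver B2 ∧ C'.size ≤ C.sizeWith w + 1 ∧ ∀ x, C'.eval x = C.eval x :=
  (Circuit.cktSize_eval_of_gadgets w hg C hC).toCircuit

/-- **Oracle circuits with `B₂`-eliminable oracle gates are plain circuits**: if every gate of
`B₂ ∪ oracleGates A` has a `B₂`-gadget of size `w`, and `Σ_g w(g) + 1 ≤ t(n)` for every
`A`-oracle circuit of fan-in-charged size `≤ s(n)` on `n` inputs, then `SIZE^A(s) ⊆ SIZE(t)`.
[cite: Wilson1985, §2 p. 172 (the model: oracle gates charged by their input wires)] -/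
theorem SIZERel_subset_SIZE_of_gadgets {A : Language Bool} {s t : ℕ → ℕ}
    (hg : ∀ g ∈ B2 ∪ oracleGates A, CktSize B2 (fun (z : Fin g.1 → Bool) (_ : Unit) => g.2 z) (w g))
    (hw : ∀ (n : ℕ) (C : Circuit (Fin n)), C.IsOver (B2 ∪ oracleGates A) → oracleSize C ≤ s n →
      C.sizeWith w + 1 ≤ t n) :
    SIZERel A s ⊆ SIZE t := by
  rintro L ⟨C, hC, hdec⟩
  choose C' hC' using fun n => Circuit.exists_B2_of_gadgets w hg (C n) (hC n).1
  refine ⟨fun n => C' n, fun n => ⟨(hC' n).1, (hC' n).2.1.trans (hw n (C n) (hC n).1 (hC n).2)⟩,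
    fun x => ?_⟩
  rw [(hC' x.length).2.2]
  exact hdec x

/-- A gate function of fan-in `≤ 2` is its own gadget (one gate of `B₂`). [folklore] -/
theorem cktSize_of_mem_B2 {g : GateFn} (hg : g ∈ B2) :
    CktSize B2 (fun (z : Fin g.1 → Bool) (_ : Unit) => g.2 z) 1 :=
  (CktSize.gate g hg id).congr fun _ _ => rfl

/-- The cost of a gate is at most the fan-in-charged size of a circuit containing it. [folklore] -/
theorem oracleGateCost_le_oracleSize {C : Circuit ι} {g : Gate ι} (hg : g ∈ C.gates) :
    oracleGateCost g.fn ≤ oracleSize C := by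
  unfold oracleSize Circuit.sizeWith
  exact List.single_le_sum (fun _ _ => Nat.zero_le _) _ (List.mem_map_of_mem hg)

/-- Weighted size is at most the number of gates times a bound on the weights. [folklore] -/
theorem sizeWith_le_size_mul (C : Circuit ι) {K : ℕ} (h : ∀ g ∈ C.gates, w g.fn ≤ K) :
    C.sizeWith w ≤ C.size * K := by
  unfold Circuit.sizeWith Circuit.size
  have := List.sum_le_card_nsmul (C.gates.map fun g => w g.fn) K (fun x hx => by
    obtain ⟨g, hg, rfl⟩ := List.mem_map.1 hx
    exact h g hg)
  simpa using this

end Gadgets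

/-! ### Tally oracles: oracle gates are `B₂`-gates in disguise -/

/-- `NOR` of `m + 1` wires by `m + 1` gates of `B₂` (a chain of `a ∧ ¬ b` gates after one
negation). [cite: Vollmer1999, §1.1] -/
theorem cktSize_allFalse : ∀ m : ℕ,
    CktSize B2 (fun (z : Fin (m + 1) → Bool) (_ : Unit) => decide (∀ j, z j = false)) (m + 1)
  | 0 => (cktSize_not (0 : Fin 1)).congr fun z _ => by
      show (!z 0) = decide (∀ j : Fin 1, z j = false)
      by_cases hall : ∀ j : Fin 1, z j = false
      · rw [decide_eq_true hall, hall 0]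
        rfl
      · rw [decide_eq_false hall]
        have h0 : z 0 ≠ false := fun h0 => hall fun j => by rwa [Subsingleton.elim j 0]
        cases hz : z 0
        · exact absurd hz h0
        · rfl
  | m + 1 => by
    have ih := cktSize_allFalse m
    have h1 : CktSize B2 (fun (z : Fin (m + 2) → Bool) =>
        Sum.elim (fun (_ : Unit) => decide (∀ j : Fin (m + 1), z j.castSucc = false))
          (fun (_ : Unit) => z (Fin.last (m + 1)))) ((m + 1) + 0) :=
      ((ih.rewire Fin.castSucc).congr fun z _ => rfl).pair (CktSize.proj B2 fun _ => Fin.last (m + 1))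
    have hgate : CktSize B2 (fun (x : Unit ⊕ Unit → Bool) (_ : Unit) =>
        (⟨2, fun v => v 0 && !(v 1)⟩ : GateFn).2 fun a => x (![Sum.inl (), Sum.inr ()] a)) 1 :=
      CktSize.gate (B := B2) ⟨2, fun v => v 0 && !(v 1)⟩ (show (2 : ℕ) ≤ 2 from le_rfl) _
    refine ((h1.comp hgate).of_le (by omega)).congr fun z _ => ?_
    simp only [Sum.elim_inl, Sum.elim_inr, Matrix.cons_val_zero, Matrix.cons_val_one,
      Fin.forall_fin_succ', Bool.decide_and]
    cases z (Fin.last (m + 1)) <;> simp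

/-- **The oracle gates of a tally language are `B₂`-eliminable at their own cost.** For tally
`T ⊆ 0*` the gate `T_m` is `NOR_m` (if `0^m ∈ T`) or the constant `0` (if not): of fan-in-charged
cost `m` (`m ≥ 3`) and `B₂`-size `≤ m`; for `m ≤ 2` it is itself a gate of `B₂`.
[cite: Schoning1995, §4 (p. 529: "by direct constructions, sparse sets have polynomial-size circuits")] -/
theorem IsTally.cktSize_oracleGate {T : Language Bool} (hT : IsTally T) (m : ℕ) :
    CktSize B2 (fun (z : Fin m → Bool) (_ : Unit) => T.sliceFn m z)
      (oracleGateCost ⟨m, T.sliceFn m⟩) := by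
  classical
  by_cases hm : m ≤ 2
  · rw [oracleGateCost_of_le hm]
    exact cktSize_of_mem_B2 (g := ⟨m, T.sliceFn m⟩) hm
  · have hcost : oracleGateCost ⟨m, T.sliceFn m⟩ = m := by simp [oracleGateCost, hm]
    rw [hcost]
    obtain ⟨k, rfl⟩ : ∃ k, m = k + 1 := ⟨m - 1, by omega⟩
    by_cases h0 : List.replicate (k + 1) false ∈ T
    · refine (cktSize_allFalse k).congr fun z _ => ?_
      change decide (∀ j, z j = false) = T.boolIndicator (List.ofFn z)
      by_cases hz : ∀ j, z j = false
      · have : List.ofFn z = List.replicate (k + 1) false := by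
          rw [show z = fun _ => false from funext hz, List.ofFn_const]
        rw [decide_eq_true hz, this, (Set.mem_iff_boolIndicator _ _).1 h0]
      · have hnot : List.ofFn z ∉ T := fun h =>
          hz fun j => hT _ h (z j) (List.mem_ofFn.2 ⟨j, rfl⟩)
        rw [decide_eq_false hz, (Set.notMem_iff_boolIndicator _ _).1 hnot]
    · refine ((cktSize_const (Fin (k + 1)) false).of_le (by omega)).congr fun z _ => ?_
      change false = T.boolIndicator (List.ofFn z)
      have hnot : List.ofFn z ∉ T := by
        intro h
        have hz : ∀ j, z j = false := fun j => hT _ h (z j) (List.mem_ofFn.2 ⟨j, rfl⟩)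
        have : List.ofFn z = List.replicate (k + 1) false := by
          rw [show z = fun _ => false from funext hz, List.ofFn_const]
        exact h0 (this ▸ h)
      rw [(Set.notMem_iff_boolIndicator _ _).1 hnot]

/-- **Tally oracle gates are free: `SIZE^T(s) ⊆ SIZE(s + 1)` for tally `T`** (the `+ 1` is one
constant gate of the simulation; conversely `SIZE(s) ⊆ SIZE^T(s)`, `SIZE_subset_SIZERel`). So
relative to a tally oracle, Wilson's oracle circuits are plain `B₂`-circuits.
[cite: Wilson1985, §2 p. 172 (the model)] [cite: Schoning1995, §4 (p. 529)] -/
theorem IsTally.SIZERel_subset_SIZE {T : Language Bool} (hT : IsTally T) (s : ℕ → ℕ) :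
    SIZERel T s ⊆ SIZE (fun n => s n + 1) := by
  refine SIZERel_subset_SIZE_of_gadgets oracleGateCost (fun g hg => ?_) (fun n C _ hs => ?_)
  · rcases hg with hg | ⟨m, rfl⟩
    · rw [oracleGateCost_of_le hg]
      exact cktSize_of_mem_B2 hg
    · exact hT.cktSize_oracleGate m
  · exact Nat.succ_le_succ hs

/-- Absorbing the extra gate: `c·n + c + 1 ≤ (c+1)·n + (c+1)`. [folklore] -/
theorem linear_succ_le (c n : ℕ) : c * n + c + 1 ≤ (c + 1) * n + (c + 1) := by
  have := add_one_mul c n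
  omega

/-- Absorbing the extra gate: `c·n^k + c + 1 ≤ (c+1)·n^k + (c+1)`. [folklore] -/
theorem pow_succ_le (c k n : ℕ) : c * n ^ k + c + 1 ≤ (c + 1) * n ^ k + (c + 1) := by
  have := add_one_mul c (n ^ k)
  omega

/-- **Relative to a tally oracle, linear size is linear size**:
`⋃_c SIZE^T(c·n + c) = ⋃_c SIZE(c·n + c)`. [cite: Wilson1985, §1.2 (a) p. 170 ("bounded linear size")] -/
theorem IsTally.iUnion_SIZERel_linear_eq {T : Language Bool} (hT : IsTally T) :
    (⋃ c : ℕ, SIZERel T (fun n => c * n + c)) = ⋃ c : ℕ, SIZE (fun n => c * n + c) := by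
  refine Set.Subset.antisymm (Set.iUnion_subset fun c => ?_)
    (Set.iUnion_mono fun c => SIZE_subset_SIZERel T _)
  exact ((hT.SIZERel_subset_SIZE _).trans (SIZE_mono fun n => linear_succ_le c n)).trans
    (Set.subset_iUnion (fun c : ℕ => SIZE (fun n => c * n + c)) (c + 1))

/-- And fixed-polynomial size is fixed-polynomial size:
`⋃_c SIZE^T(c·n^k + c) = ⋃_c SIZE(c·n^k + c)`. [cite: Wilson1985, §1.2 (b) p. 170] -/
theorem IsTally.iUnion_SIZERel_pow_eq {T : Language Bool} (hT : IsTally T) (k : ℕ) :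
    (⋃ c : ℕ, SIZERel T (fun n => c * n ^ k + c)) = ⋃ c : ℕ, SIZE (fun n => c * n ^ k + c) := by
  refine Set.Subset.antisymm (Set.iUnion_subset fun c => ?_)
    (Set.iUnion_mono fun c => SIZE_subset_SIZERel T _)
  exact ((hT.SIZERel_subset_SIZE _).trans (SIZE_mono fun n => pow_succ_le c k n)).trans
    (Set.subset_iUnion (fun c : ℕ => SIZE (fun n => c * n ^ k + c)) (c + 1))

/-! ### Sparse oracles: oracle gates are `B₂`-eliminable at polynomial cost -/

/-- **The slice of a language with few words of length `m` is a small `B₂`-circuit**: if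
`|S ∩ {0,1}^m| ≤ q` then `S_m` is the disjunction over these words `w` of the tests `z = w`,
of size `≤ q(2m + 1) + (q + 1)` (the construction of `mem_PPoly_of_isSparseLanguage`, for one
slice). [cite: Schoning1995, §4, Theorem (Karp–Lipton 1980; Berman–Hartmanis 1977), proof of (c) → (a) (p. 529)] -/
theorem cktSize_sliceFn_of_ncard_le {S : Language Bool} {m q : ℕ}
    (hq : {x : List Bool | x ∈ S ∧ x.length = m}.ncard ≤ q) :
    CktSize B2 (fun (z : Fin m → Bool) (_ : Unit) => S.sliceFn m z) (q * (2 * m + 1) + (q + 1)) := by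
  classical
  set A : Finset (List Bool) := (finite_slice S m).toFinset with hA
  have hmemA : ∀ w, w ∈ A ↔ w ∈ S ∧ w.length = m := fun w => by
    rw [hA, Set.Finite.mem_toFinset]; rfl
  have hAcard : A.card ≤ q := by
    rw [hA, ← Set.ncard_eq_toFinset_card _ (finite_slice S m)]; exact hq
  set T : ℕ := A.card with hT
  let e : Fin T → List Bool := fun t => (A.equivFin.symm t : List Bool)
  have he : ∀ t, e t ∈ S ∧ (e t).length = m := fun t => (hmemA _).1 (A.equivFin.symm t).2
  let cst : Fin T → Fin m → Bool := fun t j => (e t).get (Fin.cast (he t).2.symm j)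
  have hcst : ∀ t, List.ofFn (cst t) = e t := fun t => ofFn_get_cast (he t).2.symm
  have h1 : CktSize B2 (fun (z : Fin m → Bool) (t : Fin T) => decide (∀ j, z j = cst t j))
      (T * (2 * m + 1)) := by
    have := CktSize.pi_const (κ := Fin T) fun t => cktSize_forall_eq_const m (cst t)
    rwa [Fintype.card_fin] at this
  have h2 := h1.comp (cktSize_anyFin T)
  refine (h2.of_le (Nat.add_le_add (Nat.mul_le_mul_right _ hAcard) (Nat.succ_le_succ hAcard))).congr
    fun u _ => ?_
  change decide (∃ t : Fin T, decide (∀ j, u j = cst t j) = true) = S.boolIndicator (List.ofFn u)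
  have key : (∃ t : Fin T, decide (∀ j, u j = cst t j) = true) ↔ List.ofFn u ∈ S := by
    constructor
    · rintro ⟨t, ht⟩
      rw [decide_eq_true_eq] at ht
      have hu : List.ofFn u = e t := by rw [← hcst t]; exact congrArg List.ofFn (funext ht)
      rw [hu]; exact (he t).1
    · intro hu
      have huA : List.ofFn u ∈ A := (hmemA _).2 ⟨hu, List.length_ofFn⟩
      refine ⟨A.equivFin ⟨List.ofFn u, huA⟩, ?_⟩
      rw [decide_eq_true_eq]
      have h' : e (A.equivFin ⟨List.ofFn u, huA⟩) = List.ofFn u := by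
        simp only [e, Equiv.symm_apply_apply]
      have h'' : List.ofFn (cst (A.equivFin ⟨List.ofFn u, huA⟩)) = List.ofFn u := by
        rw [hcst, h']
      exact fun j => (congrFun (List.ofFn_injective h'') j).symm
  by_cases hu : List.ofFn u ∈ S
  · rw [(Set.mem_iff_boolIndicator _ _).1 hu, decide_eq_true_eq]; exact key.2 hu
  · rw [(Set.notMem_iff_boolIndicator _ _).1 hu, decide_eq_false_iff_not]; exact fun h => hu (key.1 h)

/-- The gadget-size bound for the oracle gates of a language of census `≤ m^a + a`, as a
function of the fan-in `t`: `(t^a + a)(2t + 1) + (t^a + a + 1)`. [cite: Schoning1995, §4 (p. 529)] -/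
def sparseGadgetBound (a t : ℕ) : ℕ := (t ^ a + a) * (2 * t + 1) + (t ^ a + a + 1)

/-- The gadget bound is monotone in the fan-in. [folklore] -/
theorem sparseGadgetBound_mono (a : ℕ) {t t' : ℕ} (h : t ≤ t') :
    sparseGadgetBound a t ≤ sparseGadgetBound a t' := by
  unfold sparseGadgetBound
  have h1 : t ^ a ≤ t' ^ a := Nat.pow_le_pow_left h a
  exact Nat.add_le_add (Nat.mul_le_mul (by omega) (by omega)) (by omega)

/-- The gadget bound is at least `1`. [folklore] -/
theorem one_le_sparseGadgetBound (a t : ℕ) : 1 ≤ sparseGadgetBound a t := by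
  unfold sparseGadgetBound; omega

/-- **Sparse oracle gates cost a polynomial: `SIZE^S(s) ⊆ SIZE(s · G_a(s) + 1)`** for `S` of census
`≤ m^a + a` (`G_a = sparseGadgetBound a`): an `S`-oracle gate of fan-in `m ≤ s` (fan-in is
charged) is replaced by its `≤ G_a(m)`-gate membership circuit. [cite: Schoning1995, §4 (pp. 528–529)] [cite: Wilson1985, §2 p. 172] -/
theorem SIZERel_subset_SIZE_of_census {S : Language Bool} {a : ℕ}
    (ha : ∀ m, {x : List Bool | x ∈ S ∧ x.length = m}.ncard ≤ m ^ a + a) (s : ℕ → ℕ) :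
    SIZERel S s ⊆ SIZE (fun n => s n * sparseGadgetBound a (s n) + 1) := by
  classical
  let w : GateFn → ℕ := fun g => if g.1 ≤ 2 then 1 else sparseGadgetBound a g.1
  refine SIZERel_subset_SIZE_of_gadgets w (fun g hg => ?_) (fun n C _ hs => ?_)
  · by_cases h2 : g.1 ≤ 2
    · simp only [w, if_pos h2]
      exact cktSize_of_mem_B2 h2
    · simp only [w, if_neg h2]
      rcases hg with hg | ⟨m, rfl⟩
      · exact absurd hg h2
      · exact cktSize_sliceFn_of_ncard_le (ha m)
  · refine Nat.succ_le_succ ?_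
    have hK : ∀ g ∈ C.gates, w g.fn ≤ sparseGadgetBound a (s n) := by
      intro g hg
      by_cases h2 : g.fn.1 ≤ 2
      · simp only [w, if_pos h2]
        exact one_le_sparseGadgetBound _ _
      · simp only [w, if_neg h2]
        refine sparseGadgetBound_mono a ?_
        have hc : oracleGateCost g.fn = g.fn.1 := by simp [oracleGateCost, h2]
        rw [← hc]
        exact (oracleGateCost_le_oracleSize hg).trans hs
    exact (sizeWith_le_size_mul w C hK).trans
      (Nat.mul_le_mul_right _ ((size_le_oracleSize C).trans hs))

/-- **Relative to a sparse oracle, oracle circuits of fixed polynomial size are plain circuits of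
polynomial size**: `SIZE^S(c·n^k + c) ⊆ P/poly` for sparse `S` (Meyer's "sparse sets have
polynomial-size circuits", gate by gate). [cite: Schoning1995, §4, Theorem (Karp–Lipton 1980; Berman–Hartmanis 1977) (pp. 528–529)] [cite: Kadin1989, §1 (p. 286)] -/
theorem IsSparseLanguage.SIZERel_pow_subset_PPoly {S : Language Bool} (hS : IsSparseLanguage S)
    (c k : ℕ) : SIZERel S (fun n => c * n ^ k + c) ⊆ PPoly := by
  obtain ⟨a, ha⟩ := hS
  refine (SIZERel_subset_SIZE_of_census ha _).trans (SIZE_subset_PPoly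
    ((C c * X ^ k + C c) * (((C c * X ^ k + C c) ^ a + C a) * (2 * (C c * X ^ k + C c) + 1) +
      ((C c * X ^ k + C c) ^ a + C a + 1)) + 1) fun n => le_of_eq ?_)
  simp [sparseGadgetBound]

/-- In particular `⋃_c SIZE^S(c·n + c) ⊆ P/poly` for sparse `S`: linear-size `S`-oracle circuits
are polynomial-size circuits. [cite: Schoning1995, §4 (pp. 528–529)] -/
theorem IsSparseLanguage.iUnion_SIZERel_linear_subset_PPoly {S : Language Bool}
    (hS : IsSparseLanguage S) : (⋃ c : ℕ, SIZERel S (fun n => c * n + c)) ⊆ PPoly := by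
  refine Set.iUnion_subset fun c => ?_
  have := hS.SIZERel_pow_subset_PPoly c 1
  simpa using this

/-- And `⋃_{k,c} SIZE^S(c·n^k + c) ⊆ P/poly`: polynomial-size `S`-oracle circuits are
polynomial-size circuits (`P^S/poly = P/poly` at the circuit level), for sparse `S`.
[cite: Schoning1995, §4 (pp. 528–529)] [cite: Kadin1989, §1 (p. 286)] -/
theorem IsSparseLanguage.iUnion_SIZERel_pow_subset_PPoly {S : Language Bool}
    (hS : IsSparseLanguage S) : (⋃ k : ℕ, ⋃ c : ℕ, SIZERel S (fun n => c * n ^ k + c)) ⊆ PPoly :=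
  Set.iUnion_subset fun k => Set.iUnion_subset fun c => hS.SIZERel_pow_subset_PPoly c k

/-! ### Oracle gates of small fan-in, for ANY oracle -/

/-- The oracle gates of `A` of fan-in at most `K` (Wilson's "questions to `A` of size no greater
than `p`", Thm. 0). [cite: Wilson1985, §2 Thm. 0 (p. 172)] -/
def oracleGatesLe (A : Language Bool) (K : ℕ) : Set GateFn :=
  {g | ∃ m, m ≤ K ∧ g = ⟨m, A.sliceFn m⟩}

/-- Small-fan-in oracle gates are oracle gates. [cite: Wilson1985, §2 (p. 172)] -/
theorem oracleGatesLe_subset (A : Language Bool) (K : ℕ) : oracleGatesLe A K ⊆ oracleGates A := by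
  rintro g ⟨m, -, rfl⟩
  exact ⟨m, rfl⟩

/-- **`SIZE^A_{≤K}(s)`**: languages decided by `A`-oracle circuit families of fan-in-charged size
`≤ s(n)` whose oracle gates at input length `n` have fan-in at most `K(n)` (query length bounded
by `K`, as in Wilson's Thm. 0 and in the FACT of his Thm. 4, "the number of functions computed by
size `N` circuits with the length of the oracle query bounded by `p`"). [cite: Wilson1985, §2 Thm. 0 (p. 172) and proof of the FACT (p. 176)] -/
noncomputable def SIZERelFanIn (A : Language Bool) (K s : ℕ → ℕ) : Set (Language Bool) :=
  {L | ∃ C : CircuitFamily,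
    (∀ n, (C n).IsOver (B2 ∪ oracleGatesLe A (K n)) ∧ oracleSize (C n) ≤ s n) ∧ C.Decides L}

/-- `SIZE^A_{≤K}(s) ⊆ SIZE^A(s)`. [cite: Wilson1985, §2 (p. 172)] -/
theorem SIZERelFanIn_subset_SIZERel (A : Language Bool) (K s : ℕ → ℕ) :
    SIZERelFanIn A K s ⊆ SIZERel A s := by
  rintro L ⟨C, hC, hdec⟩
  exact ⟨C, fun n => ⟨(hC n).1.mono (Set.union_subset_union_right _ (oracleGatesLe_subset A _)),
    (hC n).2⟩, hdec⟩

/-- `SIZE(s) ⊆ SIZE^A_{≤K}(s)` (plain circuits use no oracle gates). [cite: Wilson1985, §2 (p. 172)] -/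
theorem SIZE_subset_SIZERelFanIn (A : Language Bool) (K s : ℕ → ℕ) :
    SIZE s ⊆ SIZERelFanIn A K s := by
  rintro L ⟨C, hC, hdec⟩
  refine ⟨C, fun n => ⟨fun g hg => Or.inl ((hC n).1 g hg), ?_⟩, hdec⟩
  rw [sizeWith_oracleGateCost_of_isOver_B2 (hC n).1]
  exact (hC n).2

/-- The universal bound is `5 · 2^m - 4`. [cite: AroraBarakCC2009, Claim 2.13] -/
theorem univBound_add_four_le (m : ℕ) : univBound m + 4 ≤ 5 * 2 ^ m := by
  induction m with
  | zero => simp [univBound]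
  | succ m ih => simp only [univBound, pow_succ]; omega

/-- The universal bound is at most `5 · 2^m`. [cite: AroraBarakCC2009, Claim 2.13] -/
theorem univBound_le (m : ℕ) : univBound m ≤ 5 * 2 ^ m :=
  le_of_add_le_left (univBound_add_four_le m)

/-- **Oracle gates of fan-in `≤ K` cost at most `5 · 2^K` plain gates, whatever the oracle**:
`SIZE^A_{≤K}(s) ⊆ SIZE(s · univBound(K) + 1)` for EVERY `A` — an oracle gate of fan-in `m ≤ K(n)`
is replaced by the Shannon-expansion circuit of the function `A_m` (`cktSize_univ_fin`). In
particular for `K(n) = O(log n)` this is a polynomial overhead. [cite: AroraBarakCC2009, Claim 2.13] [cite: Wilson1985, §2 Thm. 0 (p. 172)] -/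
theorem SIZERelFanIn_subset_SIZE (A : Language Bool) (K s : ℕ → ℕ) :
    SIZERelFanIn A K s ⊆ SIZE (fun n => s n * univBound (K n) + 1) := by
  classical
  rintro L ⟨C, hC, hdec⟩
  let w : GateFn → ℕ := fun g => if g.1 ≤ 2 then 1 else univBound g.1
  have hg : ∀ n, ∀ g ∈ B2 ∪ oracleGatesLe A (K n),
      CktSize B2 (fun (z : Fin g.1 → Bool) (_ : Unit) => g.2 z) (w g) := by
    intro n g hg
    by_cases h2 : g.1 ≤ 2
    · simp only [w, if_pos h2]
      exact cktSize_of_mem_B2 h2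
    · simp only [w, if_neg h2]
      exact cktSize_univ_fin g.1 _
  choose C' hC' using fun n => Circuit.exists_B2_of_gadgets w (hg n) (C n) (hC n).1
  refine ⟨fun n => C' n, fun n => ⟨(hC' n).1, (hC' n).2.1.trans (Nat.succ_le_succ ?_)⟩, fun x => ?_⟩
  · have hK : ∀ g ∈ (C n).gates, w g.fn ≤ univBound (K n) := by
      intro g hg'
      by_cases h2 : g.fn.1 ≤ 2
      · simp only [w, if_pos h2]
        exact univBound_pos _
      · simp only [w, if_neg h2]
        rcases (hC n).1 g hg' with hB | ⟨m, hm, hgm⟩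
        · exact absurd hB h2
        · refine univBound_mono ?_
          rw [hgm]
          exact hm
    exact (sizeWith_le_size_mul w (C n) hK).trans
      (Nat.mul_le_mul_right _ ((size_le_oracleSize (C n)).trans (hC n).2))
  · rw [(hC' x.length).2.2]
    exact hdec x

/-- **If `2^{K(n)}` is polynomially bounded, linear-size oracle circuits with oracle fan-in `≤ K`
are polynomial-size plain circuits, for every oracle**: `⋃_c SIZE^A_{≤K}(c·n + c) ⊆ P/poly`.
[cite: AroraBarakCC2009, Claim 2.13 and Def. 6.5] -/
theorem iUnion_SIZERelFanIn_linear_subset_PPoly (A : Language Bool) {K : ℕ → ℕ} (p : Polynomial ℕ)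
    (hK : ∀ n, 2 ^ K n ≤ p.eval n) :
    (⋃ c : ℕ, SIZERelFanIn A K (fun n => c * n + c)) ⊆ PPoly := by
  refine Set.iUnion_subset fun c => (SIZERelFanIn_subset_SIZE A K _).trans
    (SIZE_subset_PPoly ((C c * X + C c) * (5 * p) + 1) fun n => ?_)
  simp only [eval_add, eval_mul, eval_C, eval_X, eval_ofNat, eval_one]
  exact Nat.succ_le_succ (Nat.mul_le_mul_left _ ((univBound_le _).trans
    (Nat.mul_le_mul_left 5 (hK n))))

/-! ### `P/poly` and the fixed-polynomial classes -/

/-- `p(n) ≤ p(1) · n^{deg p} + p(1)` for a polynomial over `ℕ`. [folklore] -/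
theorem natPoly_eval_le_pow (p : Polynomial ℕ) (n : ℕ) :
    p.eval n ≤ p.eval 1 * n ^ p.natDegree + p.eval 1 := by
  rw [eval_eq_sum_range, eval_eq_sum_range]
  simp only [one_pow, mul_one]
  have key : ∀ i ∈ Finset.range (p.natDegree + 1),
      p.coeff i * n ^ i ≤ p.coeff i * n ^ p.natDegree + p.coeff i := by
    intro i hi
    have hi' : i ≤ p.natDegree := Nat.lt_succ_iff.1 (Finset.mem_range.1 hi)
    rcases Nat.eq_zero_or_pos n with rfl | hn
    · rcases Nat.eq_zero_or_pos i with rfl | hi0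
      · simp
      · simp [Nat.zero_pow hi0]
    · exact (Nat.mul_le_mul_left _ (Nat.pow_le_pow_right hn hi')).trans (Nat.le_add_right _ _)
  calc ∑ i ∈ Finset.range (p.natDegree + 1), p.coeff i * n ^ i
      ≤ ∑ i ∈ Finset.range (p.natDegree + 1), (p.coeff i * n ^ p.natDegree + p.coeff i) :=
        Finset.sum_le_sum key
    _ = (∑ i ∈ Finset.range (p.natDegree + 1), p.coeff i) * n ^ p.natDegree +
          ∑ i ∈ Finset.range (p.natDegree + 1), p.coeff i := by
        rw [Finset.sum_add_distrib, Finset.sum_mul]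

/-- `L ∉ P/poly ↔ L ∉ SIZE(c·n^k + c)` for all `k, c`. [cite: AroraBarakCC2009, Def. 6.5] -/
theorem not_mem_PPoly_iff (L : Language Bool) :
    L ∉ PPoly ↔ ∀ k c : ℕ, L ∉ SIZE (fun n => c * n ^ k + c) := by
  constructor
  · intro h k c hL
    exact h (SIZE_subset_PPoly (C c * X ^ k + C c) (fun n => by simp) hL)
  · intro h hL
    obtain ⟨p, hp⟩ := Set.mem_iUnion.1 hL
    exact h p.natDegree (p.eval 1) (SIZE_mono (fun n => natPoly_eval_le_pow p n) hp)

/-! ### Positive relativization over tally and sparse oracles (generic in the class) -/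

section Positive

variable {𝒞 : Language Bool → Set (Language Bool)} {C₀ : Set (Language Bool)}

/-- **Superlinear lower bounds relativize over tally oracles iff they hold.** For a relativized
class `A ↦ 𝒞^A` with `𝒞^∅ = C₀ ⊆ 𝒞^A`: "for every tally `T` some language of `𝒞^T` has no
linear-size `T`-oracle circuits" is EQUIVALENT to "some language of `C₀` has no linear-size
circuits" — the tally-oracle gates being `B₂`-gates (`IsTally.SIZERel_subset_SIZE`) and `∅`
being tally. The circuit-size analogue of Long–Selman's `P = NP ↔ ∀ tally T, P^T = NP^T`
(`longSelman1986_tally`), here a theorem outright. [cite: LongSelman1986, abstract] [cite: Wilson1985, §1.2 (a) p. 170] -/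
theorem tally_superlinear_iff (h0 : 𝒞 0 = C₀) (hmono : ∀ A, C₀ ⊆ 𝒞 A) :
    (∀ T, IsTally T → ∃ L ∈ 𝒞 T, ∀ c : ℕ, L ∉ SIZERel T (fun n => c * n + c)) ↔
      ∃ L ∈ C₀, ∀ c : ℕ, L ∉ SIZE (fun n => c * n + c) := by
  constructor
  · intro h
    obtain ⟨L, hL, hc⟩ := h 0 isTally_zero
    exact ⟨L, h0 ▸ hL, fun c hLc => hc c (SIZE_subset_SIZERel 0 _ hLc)⟩
  · rintro ⟨L, hL, hc⟩ T hT
    exact ⟨L, hmono T hL, fun c hLc =>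
      hc (c + 1) (SIZE_mono (fun n => linear_succ_le c n) (hT.SIZERel_subset_SIZE _ hLc))⟩

/-- **Fixed-polynomial lower bounds relativize over tally oracles iff they hold** (the shape of
Wilson's Thm. 4 / Kannan's theorem: for every `k` a language outside `SIZE(O(n^k))`).
[cite: Wilson1985, §1.2 (b) p. 170 and Thm. 4] [cite: Kannan1982, Thm. 4] -/
theorem tally_fixedPoly_iff (h0 : 𝒞 0 = C₀) (hmono : ∀ A, C₀ ⊆ 𝒞 A) :
    (∀ T, IsTally T → ∀ k : ℕ, ∃ L ∈ 𝒞 T, ∀ c : ℕ, L ∉ SIZERel T (fun n => c * n ^ k + c)) ↔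
      ∀ k : ℕ, ∃ L ∈ C₀, ∀ c : ℕ, L ∉ SIZE (fun n => c * n ^ k + c) := by
  constructor
  · intro h k
    obtain ⟨L, hL, hc⟩ := h 0 isTally_zero k
    exact ⟨L, h0 ▸ hL, fun c hLc => hc c (SIZE_subset_SIZERel 0 _ hLc)⟩
  · intro h T hT k
    obtain ⟨L, hL, hc⟩ := h k
    exact ⟨L, hmono T hL, fun c hLc =>
      hc (c + 1) (SIZE_mono (fun n => pow_succ_le c k n) (hT.SIZERel_subset_SIZE _ hLc))⟩

/-- **Super-polynomial lower bounds (`𝒞 ⊄ P/poly`) relativize over tally oracles iff they hold.**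
[cite: Wilson1985, Prop. 1 (p. 172)] [cite: LongSelman1986, abstract] -/
theorem tally_superpoly_iff (h0 : 𝒞 0 = C₀) (hmono : ∀ A, C₀ ⊆ 𝒞 A) :
    (∀ T, IsTally T → ∃ L ∈ 𝒞 T, ∀ k c : ℕ, L ∉ SIZERel T (fun n => c * n ^ k + c)) ↔
      ¬ C₀ ⊆ PPoly := by
  rw [Set.not_subset]
  constructor
  · intro h
    obtain ⟨L, hL, hc⟩ := h 0 isTally_zero
    exact ⟨L, h0 ▸ hL, (not_mem_PPoly_iff L).2 fun k c hLc => hc k c (SIZE_subset_SIZERel 0 _ hLc)⟩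
  · rintro ⟨L, hL, hLP⟩ T hT
    refine ⟨L, hmono T hL, fun k c hLc => (not_mem_PPoly_iff L).1 hLP k (c + 1) ?_⟩
    exact SIZE_mono (fun n => pow_succ_le c k n) (hT.SIZERel_subset_SIZE _ hLc)

/-- **No sparse barrier unless `C₀ ⊆ P/poly`**: if some language of `C₀` lies outside `P/poly`,
then relative to EVERY sparse oracle `S` it lies (in `𝒞^S` and) outside all the classes
`SIZE^S(c·n^k + c)` — the superpolynomial, hence the fixed-polynomial and the superlinear
lower-bound shapes for `𝒞` hold relative to every sparse oracle. [cite: Schoning1995, §3 (p. 527) and §4 (pp. 528–529)] -/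
theorem sparse_superpoly_of_not_subset_PPoly (hmono : ∀ A, C₀ ⊆ 𝒞 A) (h : ¬ C₀ ⊆ PPoly)
    {S : Language Bool} (hS : IsSparseLanguage S) :
    ∃ L ∈ 𝒞 S, ∀ k c : ℕ, L ∉ SIZERel S (fun n => c * n ^ k + c) := by
  obtain ⟨L, hL, hLP⟩ := Set.not_subset.1 h
  exact ⟨L, hmono S hL, fun k c hLc => hLP (hS.SIZERel_pow_subset_PPoly c k hLc)⟩

/-- Superlinear form of `sparse_superpoly_of_not_subset_PPoly`. [cite: Schoning1995, §3 (p. 527)] [cite: Wilson1985, §1.2 (a) p. 170] -/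
theorem sparse_superlinear_of_not_subset_PPoly (hmono : ∀ A, C₀ ⊆ 𝒞 A) (h : ¬ C₀ ⊆ PPoly)
    {S : Language Bool} (hS : IsSparseLanguage S) :
    ∃ L ∈ 𝒞 S, ∀ c : ℕ, L ∉ SIZERel S (fun n => c * n + c) := by
  obtain ⟨L, hL, hc⟩ := sparse_superpoly_of_not_subset_PPoly hmono h hS
  exact ⟨L, hL, fun c hLc => hc 1 c (by simpa using hLc)⟩

/-- **A sparse contrary world forces `C₀ ⊆ P/poly`**: if relative to a SPARSE `S` every language
of `𝒞^S` has linear-size `S`-oracle circuits (the conclusion of Wilson's Thm. 3.1 at `S`), then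
`C₀ ⊆ 𝒞^S ⊆ ⋃_c SIZE^S(c·n + c) ⊆ P/poly`. [cite: Schoning1995, §4 (pp. 528–529)] [cite: Wilson1985, Thm. 3.1 (p. 175)] -/
theorem subset_PPoly_of_sparse_linear (hmono : ∀ A, C₀ ⊆ 𝒞 A) {S : Language Bool}
    (hS : IsSparseLanguage S) (h : 𝒞 S ⊆ ⋃ c : ℕ, SIZERel S (fun n => c * n + c)) :
    C₀ ⊆ PPoly :=
  ((hmono S).trans h).trans hS.iUnion_SIZERel_linear_subset_PPoly

/-- The same from the weaker collapse `𝒞^S ⊆ ⋃_{k,c} SIZE^S(c·n^k + c)` (`𝒞^S ⊆ P^S/poly`).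
[cite: Schoning1995, §4 (pp. 528–529)] [cite: Kadin1989, §1 (p. 286)] -/
theorem subset_PPoly_of_sparse_poly (hmono : ∀ A, C₀ ⊆ 𝒞 A) {S : Language Bool}
    (hS : IsSparseLanguage S) (h : 𝒞 S ⊆ ⋃ k : ℕ, ⋃ c : ℕ, SIZERel S (fun n => c * n ^ k + c)) :
    C₀ ⊆ PPoly :=
  ((hmono S).trans h).trans hS.iUnion_SIZERel_pow_subset_PPoly

/-- **Nor can oracle gates of logarithmic fan-in carry the barrier**: if relative to ANY oracle
`A` every language of `𝒞^A` has linear-size `A`-oracle circuits whose oracle gates have fan-in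
`≤ K(n)` with `2^{K(n)} ≤ poly(n)`, then `C₀ ⊆ P/poly`. [cite: Wilson1985, §2 Thm. 0 (p. 172) and Lemma 2 (p. 173: one oracle gate of fan-in `2n + o(n)`)] [cite: AroraBarakCC2009, Claim 2.13] -/
theorem subset_PPoly_of_fanIn_linear (hmono : ∀ A, C₀ ⊆ 𝒞 A) {K : ℕ → ℕ} (p : Polynomial ℕ)
    (hK : ∀ n, 2 ^ K n ≤ p.eval n) {A : Language Bool}
    (h : 𝒞 A ⊆ ⋃ c : ℕ, SIZERelFanIn A K (fun n => c * n + c)) : C₀ ⊆ PPoly :=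
  ((hmono A).trans h).trans (iUnion_SIZERelFanIn_linear_subset_PPoly A p hK)

end Positive

/-! ### The instances `NP`, `P`, `Δ₂ᵖ` -/

/-- `NP^∅ = NP` (tree theorems `NPRel_eq`, `PRel_empty_holds`). [cite: BakerGillSolovay1975, §1] -/
theorem NPRel_zero : NPRel (Oracle.ofLanguage 0) = NP := by
  show NPRel Oracle.empty = NP
  have hE : PRel Oracle.empty = P := PRel_empty_holds
  rw [NPRel_eq, hE]
  rfl

/-- `P^∅ = P` (the tree theorem `PRel_empty_holds`). [cite: BakerGillSolovay1975, §1] -/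
theorem PRel_zero : PRel (Oracle.ofLanguage 0) = P :=
  PRel_empty_holds

/-- `Δ₂^{P,∅} = P^{NP} = Δ₂ᵖ`. [cite: Wilson1985, §2 p. 171] -/
theorem deltaTwoRel_zero : DeltaTwoRel 0 = PRelClass NP := by
  unfold DeltaTwoRel
  rw [NPRel_zero]

/-- `Δ₂ᵖ ⊆ Δ₂^{P,A}` for every oracle language `A`. [cite: Wilson1985, §2 p. 171] -/
theorem deltaTwo_subset_deltaTwoRel (A : Language Bool) : PRelClass NP ⊆ DeltaTwoRel A :=
  PRelClass_mono (NP_subset_NPRel _)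

/-- **(NP, tally) Superlinear circuit lower bounds for `NP` relativize over tally oracles iff
they hold.** [cite: Wilson1985, §1.2 (a) p. 170] [cite: LongSelman1986, abstract] -/
theorem np_tally_superlinear_iff :
    (∀ T, IsTally T → ∃ L ∈ NPRel (Oracle.ofLanguage T), ∀ c : ℕ,
        L ∉ SIZERel T (fun n => c * n + c)) ↔
      ∃ L ∈ NP, ∀ c : ℕ, L ∉ SIZE (fun n => c * n + c) :=
  tally_superlinear_iff (𝒞 := fun A => NPRel (Oracle.ofLanguage A)) NPRel_zero
    fun _ => NP_subset_NPRel _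

/-- **(NP, tally) Fixed-polynomial lower bounds `∀ k, NP ⊄ SIZE(O(n^k))` relativize over tally
oracles iff they hold.** [cite: Wilson1985, §1.2 (b) p. 170 and p. 175] [cite: Kannan1982, Thm. 4] -/
theorem np_tally_fixedPoly_iff :
    (∀ T, IsTally T → ∀ k : ℕ, ∃ L ∈ NPRel (Oracle.ofLanguage T), ∀ c : ℕ,
        L ∉ SIZERel T (fun n => c * n ^ k + c)) ↔
      ∀ k : ℕ, ∃ L ∈ NP, ∀ c : ℕ, L ∉ SIZE (fun n => c * n ^ k + c) :=
  tally_fixedPoly_iff (𝒞 := fun A => NPRel (Oracle.ofLanguage A)) NPRel_zero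
    fun _ => NP_subset_NPRel _

/-- **(NP, tally) `NP ⊄ P/poly` relativizes over tally oracles (with `T`-oracle gates) iff it
holds.** [cite: Wilson1985, Prop. 1 (p. 172)] [cite: LongSelman1986, abstract] -/
theorem np_tally_superpoly_iff :
    (∀ T, IsTally T → ∃ L ∈ NPRel (Oracle.ofLanguage T), ∀ k c : ℕ,
        L ∉ SIZERel T (fun n => c * n ^ k + c)) ↔ ¬ NP ⊆ PPoly :=
  tally_superpoly_iff (𝒞 := fun A => NPRel (Oracle.ofLanguage A)) NPRel_zero
    fun _ => NP_subset_NPRel _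

/-- **(P, tally)** The same for `P`: superlinear lower bounds for `P` relativize over tally
oracles iff they hold. [cite: Wilson1985, §1.2 (a) p. 170 ("sets in P")] -/
theorem p_tally_superlinear_iff :
    (∀ T, IsTally T → ∃ L ∈ PRel (Oracle.ofLanguage T), ∀ c : ℕ,
        L ∉ SIZERel T (fun n => c * n + c)) ↔
      ∃ L ∈ P, ∀ c : ℕ, L ∉ SIZE (fun n => c * n + c) :=
  tally_superlinear_iff (𝒞 := fun A => PRel (Oracle.ofLanguage A)) PRel_zero
    fun _ => P_subset_PRel_holds _

/-- **(Δ₂ᵖ, tally)** The same for `Δ₂ᵖ = P^{NP}` (the class of Wilson's Thm. 3.1): superlinear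
lower bounds for `Δ₂ᵖ` relativize over tally oracles iff they hold. [cite: Wilson1985, Thm. 3.1 (p. 175)] -/
theorem deltaTwo_tally_superlinear_iff :
    (∀ T, IsTally T → ∃ L ∈ DeltaTwoRel T, ∀ c : ℕ, L ∉ SIZERel T (fun n => c * n + c)) ↔
      ∃ L ∈ PRelClass NP, ∀ c : ℕ, L ∉ SIZE (fun n => c * n + c) :=
  tally_superlinear_iff (𝒞 := DeltaTwoRel) deltaTwoRel_zero deltaTwo_subset_deltaTwoRel

/-- **(NP, sparse) Unless `NP ⊆ P/poly`, relative to EVERY sparse oracle `S` some `NP`-language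
(of `NP ⊆ NP^S`) has no `S`-oracle circuits of any polynomial size — so the superlinear,
fixed-polynomial and `P/poly` lower-bound shapes for `NP` all hold relative to every sparse
oracle.** [cite: Schoning1995, §3 (p. 527) and §4 (pp. 528–529)] -/
theorem np_sparse_superpoly (hNP : ¬ NP ⊆ PPoly) {S : Language Bool} (hS : IsSparseLanguage S) :
    ∃ L ∈ NPRel (Oracle.ofLanguage S), ∀ k c : ℕ, L ∉ SIZERel S (fun n => c * n ^ k + c) :=
  sparse_superpoly_of_not_subset_PPoly (𝒞 := fun A => NPRel (Oracle.ofLanguage A))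
    (fun _ => NP_subset_NPRel _) hNP hS

/-- **(NP, sparse) A sparse oracle with `NP^S ⊆ ⋃_c SIZE^S(c·n + c)` forces `NP ⊆ P/poly`.**
[cite: Schoning1995, §4 (pp. 528–529)] [cite: Kadin1989, §1 (p. 286)] -/
theorem NP_subset_PPoly_of_sparse_np_linear {S : Language Bool} (hS : IsSparseLanguage S)
    (h : NPRel (Oracle.ofLanguage S) ⊆ ⋃ c : ℕ, SIZERel S (fun n => c * n + c)) : NP ⊆ PPoly :=
  subset_PPoly_of_sparse_linear (𝒞 := fun A => NPRel (Oracle.ofLanguage A))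
    (fun _ => NP_subset_NPRel _) hS h

/-- **(Δ₂ᵖ, sparse) A SPARSE oracle with the conclusion of Wilson's Thm. 3.1,
`Δ₂^{P,S} ⊆ ⋃_c SIZE^S(c·n + c)`, forces `NP ⊆ P/poly`** (`NP ⊆ NP^S ⊆ Δ₂^{P,S}`, tree theorem
`self_subset_PRelClass_holds`). [cite: Wilson1985, Thm. 3.1 (p. 175)] [cite: Schoning1995, §4 (pp. 528–529)] -/
theorem NP_subset_PPoly_of_sparse_deltaTwo_linear {S : Language Bool} (hS : IsSparseLanguage S)
    (h : DeltaTwoRel S ⊆ ⋃ c : ℕ, SIZERel S (fun n => c * n + c)) : NP ⊆ PPoly :=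
  NP_subset_PPoly_of_sparse_np_linear hS
    ((NPRel_subset_deltaTwoRel self_subset_PRelClass_holds S).trans h)

/-- **Wilson's oracle `B` is dense (unless `NP ⊆ P/poly`)**: every oracle `B` with
`Δ₂^{P,B} ⊆ ⋃_c SIZE^B(c·n + c)` — in particular the `B` of Thm. 3.1 — is NOT sparse, unless
`NP ⊆ P/poly`. (Lemma 2's `B` answers one query `⟨i,x⟩α` per machine `i` and input `x`: it has
`2^{Ω(m)}` words of length `m`.) [cite: Wilson1985, Lemma 2 (pp. 173–175) and Thm. 3.1] -/
theorem not_isSparseLanguage_of_deltaTwo_linear (hNP : ¬ NP ⊆ PPoly) {B : Language Bool}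
    (h : DeltaTwoRel B ⊆ ⋃ c : ℕ, SIZERel B (fun n => c * n + c)) : ¬ IsSparseLanguage B :=
  fun hB => hNP (NP_subset_PPoly_of_sparse_deltaTwo_linear hB h)

/-- From the fact `Wilson1985_thm_3_1`: unless `NP ⊆ P/poly`, there is a DENSE (non-sparse)
oracle relative to which `Δ₂ᵖ` has linear-size circuits, and no sparse one.
[cite: Wilson1985, Thm. 3.1 (p. 175)] -/
theorem Wilson1985_thm_3_1.oracle_dense (h : Wilson1985_thm_3_1) (hNP : ¬ NP ⊆ PPoly) :
    (∃ B : Language Bool, DeltaTwoRel B ⊆ (⋃ c : ℕ, SIZERel B (fun n => c * n + c)) ∧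
        ¬ IsSparseLanguage B) ∧
      ∀ S : Language Bool, IsSparseLanguage S →
        ¬ DeltaTwoRel S ⊆ ⋃ c : ℕ, SIZERel S (fun n => c * n + c) := by
  obtain ⟨B, hB⟩ := h.deltaTwo_subset_linear
  exact ⟨⟨B, hB, not_isSparseLanguage_of_deltaTwo_linear hNP hB⟩,
    fun S hS hSl => not_isSparseLanguage_of_deltaTwo_linear hNP hSl hS⟩

/-- **(NP, small fan-in) For EVERY oracle `A`: if `NP^A` has linear-size `A`-oracle circuits whose
oracle gates have fan-in `≤ K(n)`, `2^{K(n)} ≤ poly(n)`, then `NP ⊆ P/poly`.** Wilson's circuits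
(one oracle gate of fan-in `2n + o(n)`) are as narrow as the barrier allows up to the exponent:
logarithmic fan-in carries no barrier. [cite: Wilson1985, Lemma 2 (p. 173, Fig. 1) and p. 175 (size `n + |α| = log T + n + 3 + n`)] -/
theorem NP_subset_PPoly_of_fanIn_np_linear {K : ℕ → ℕ} (p : Polynomial ℕ)
    (hK : ∀ n, 2 ^ K n ≤ p.eval n) {A : Language Bool}
    (h : NPRel (Oracle.ofLanguage A) ⊆ ⋃ c : ℕ, SIZERelFanIn A K (fun n => c * n + c)) :
    NP ⊆ PPoly :=
  subset_PPoly_of_fanIn_linear (𝒞 := fun A => NPRel (Oracle.ofLanguage A))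
    (fun _ => NP_subset_NPRel _) p hK h

/-! ### In the catalogue's vocabulary `CRelativizes` -/

/-- **Tally-relativizing proofs of superlinear bounds for `NP` are not obstructed**: any
oracle-indexed statement implied at each language oracle by the superlinear-`NP` shape is
`TALLY`-relativizing as soon as the unrelativized superlinear bound holds. [cite: Wilson1985, §1.2 (a) p. 170] [cite: HiraharaLuRen2023, §1.1 (p. 3)] -/
theorem cRelativizes_tally_of_np_superlinear {Φ : Oracle → Prop}
    (hΦ : ∀ A : Language Bool, (∃ L ∈ NPRel (Oracle.ofLanguage A), ∀ c : ℕ,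
      L ∉ SIZERel A (fun n => c * n + c)) → Φ (Oracle.ofLanguage A))
    (h : ∃ L ∈ NP, ∀ c : ℕ, L ∉ SIZE (fun n => c * n + c)) :
    CRelativizes {T | IsTally T} Φ :=
  fun T hT => hΦ T (np_tally_superlinear_iff.2 h T hT)

/-- **Sparse-relativizing proofs of circuit lower bounds for `NP` are not obstructed unless
`NP ⊆ P/poly`**: any statement implied at each language oracle by the `NP^A ⊄ P^A/poly` shape
(a fortiori by the superlinear or fixed-polynomial shapes) is `SPARSE`-relativizing if
`NP ⊄ P/poly`. [cite: Schoning1995, §3 (p. 527)] [cite: HiraharaLuRen2023, §1.1 (p. 3)] -/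
theorem cRelativizes_sparse_of_NP_not_subset_PPoly {Φ : Oracle → Prop}
    (hΦ : ∀ A : Language Bool, (∃ L ∈ NPRel (Oracle.ofLanguage A), ∀ k c : ℕ,
      L ∉ SIZERel A (fun n => c * n ^ k + c)) → Φ (Oracle.ofLanguage A))
    (hNP : ¬ NP ⊆ PPoly) : CRelativizes {S | IsSparseLanguage S} Φ :=
  fun _ hS => hΦ _ (np_sparse_superpoly hNP hS)

/-- **Exact reach over sparse oracles**: if a statement fails only where `NP^A` collapses to
linear-size `A`-oracle circuits (as the superlinear-`NP` shape does), then its failure to be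
`SPARSE`-relativizing proves `NP ⊆ P/poly`. [cite: Schoning1995, §3 (p. 527) and §4 (pp. 528–529)] -/
theorem NP_subset_PPoly_of_not_cRelativizes_sparse_np {Φ : Oracle → Prop}
    (hΦ : ∀ A : Language Bool, ¬ Φ (Oracle.ofLanguage A) →
      NPRel (Oracle.ofLanguage A) ⊆ ⋃ c : ℕ, SIZERel A (fun n => c * n + c))
    (h : ¬ CRelativizes {S | IsSparseLanguage S} Φ) : NP ⊆ PPoly := by
  obtain ⟨S, hS, hnot⟩ := (not_cRelativizes_iff _ _).1 h
  exact NP_subset_PPoly_of_sparse_np_linear hS (hΦ S hnot)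

/-! ### The narrowed barrier entry -/

/-- **Relativized circuit size, narrowed (audit 2026-08-16): Wilson's contrary oracles, with the
density and gate-width data that carry them.** Wilson's Thm. 3.1 and Thm. 4 (the fact
`RelativizedCircuitSize`, unchanged and proved in the tree, `RelativizedCircuitSize_holds`),
together with the three PROVED riders of this file: (i) over tally oracles the oracle gates are
`B₂`-gates, so superlinear / fixed-polynomial / `P/poly` lower bounds for `NP` (for `P`, `Δ₂ᵖ`)
relativize over tally oracles iff they hold; (ii) a sparse oracle carrying the linear-size
collapse of `NP^S` (a fortiori of `Δ₂^{P,S}`) exists only if `NP ⊆ P/poly`, so Wilson's `B` is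
dense; (iii) for every oracle, a linear-size collapse of `NP^A` by oracle gates of fan-in `K(n)`
with `2^{K(n)} ≤ poly(n)` forces `NP ⊆ P/poly`.

BARRIER
technique_class: relativizing (over ALL language oracles, DENSE ones included, in Wilson's oracle-circuit model `SIZERel`: `B₂` plus `A_m`-gates of ARBITRARY fan-in `m` charged `m`), oracle-independent (same sense), black-box-circuit arguments (circuits used only through evaluation and counting: diagonalization à la Kannan, Karp–Lipton collapses, learning with an `NP` oracle); `diagonalization, simulation` ONLY insofar as the whole argument relativizes in this sense
blocks: relativizing proofs — robust under EVERY language oracle with oracle gates of UNBOUNDED (≥ `2n + o(n)`) fan-in — of NON-UNIFORM superlinear, fixed-polynomial or superpolynomial circuit-size lower bounds for languages of `P`, `NP`, `Δ₂ᵖ` (route PneNP/Circuit cruxes #2 `CircuitSuperlinear`, #4 `NP ⊄ SIZE(n^k)`, thesis `NP ⊄ P/poly`; route PneNP/Circuit2 crux #3 `SAT ∉ SIZE(O(n²))`), and relativizing proofs of fixed-polynomial UPPER bounds for `P` (`Wilson1985_thm_4.not_relativizes_fixedPoly_upper`) [cite: Wilson1985, §1.2 (a)–(b) p. 170, Thms.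 3.1 and 4] [cite: Aaronson2006, §1 and §1.3 (arXiv pp. 3, 6: the "relativization barrier" for superlinear size runs below `BPP^{NP}_{||}`, `PP`)]. It does NOT block: (a) arguments robust only under TALLY oracles — over tally `T`, `SIZE^T(s) ⊆ SIZE(s+1)` and each lower-bound shape for `NP`/`P`/`Δ₂ᵖ` is tally-relativizing iff true (`np_tally_superlinear_iff`, `np_tally_fixedPoly_iff`, `np_tally_superpoly_iff`, `p_tally_superlinear_iff`, `deltaTwo_tally_superlinear_iff`); (b) arguments robust only under SPARSE oracles (polynomial advice with oracle-gate access) — unless `NP ⊆ P/poly`, i.e. unless the route's thesis is false, every lower-bound shape for `NP` holds relative to every sparse oracle (`np_sparse_superpoly`, `cRelativizes_sparse_of_NP_not_subset_PPoly`), a sparse contrary world would itself prove `NP ⊆ P/poly` (`NP_subset_PPoly_of_sparse_np_linear`, `NP_subset_PPoly_of_sparse_deltaTwo_linear`) and Wilson's `B` is dense (`not_isSparseLanguage_of_deltaTwo_linear`, `Wilson1985_thm_3_1.oracle_dense`); (c) arguments robust only under oracle gates of fan-in `K(n) = O(log n)`, for ANY oracle (`NP_subset_PPoly_of_fanIn_np_linear`;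 Wilson's circuit is ONE oracle gate of fan-in `2n + o(n)`, Lemma 2 Fig. 1, and his own counting bound, Thm. 0 and the FACT of Thm. 4, is parametrised by the query length); (d) lower bounds against UNIFORM circuit families — `∀ k, P ⊄ P-uniform SIZE(n^k)` and `NP ⊄ P^{NP}_{||}-uniform SIZE(n^k)` are theorems, by diagonalization [cite: SanthanamWilliams2014, Thms. 1.1 and 1.3], Wilson's circuits hard-wiring the non-uniform stage strings `α_N` [cite: Wilson1985, Lemma 2 (pp. 173–175)]; (e) any argument sensitive to gate fan-in or circuit structure (gate elimination: Blum's `3n > 2n + o(n)` [cite: Wilson1985, p. 175]; random restrictions, formula/depth arguments; SAT-algorithm-based diagonalization, Williams' "algorithmic method"), all trivially non-relativizing against one gate of fan-in `2n` (Fortnow: "although one can easily relativize circuits [Wil85], many researchers believed the structure of circuits would allow us to find nonrelativizable techniques" [cite: Fortnow1994, §3.3 (p. 4 of the author's version)]).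
because: Wilson's `B` (Lemma 2) answers the single query `⟨i,x⟩α_N` of a one-gate circuit of fan-in `2n + o(n)`, for every `Δ₂` machine `i` and input `x` — an oracle with `2^{Ω(m)}` words per length `m` and a gate as wide as the input [cite: Wilson1985, Lemma 2 and its proof (pp. 173–175), Fig. 1]; relative to a TALLY oracle an oracle gate `T_m` is `NOR_m` or a constant, of `B₂`-size `≤` its charged cost (`IsTally.cktSize_oracleGate`, `IsTally.SIZERel_subset_SIZE`); relative to a SPARSE oracle of census `≤ m^a + a` it is a disjunction of word tests of size `≤ (m^a+a)(2m+1) + m^a+a+1` (`cktSize_sliceFn_of_ncard_le`, `SIZERel_subset_SIZE_of_census`), so `⋃_c SIZE^S(c·n^k + c) ⊆ P/poly` (`IsSparseLanguage.SIZERel_pow_subset_PPoly`) and `NP ⊆ NP^S`; an oracle gate of fan-in `m ≤ K(n)` of ANY oracle is a Shannon-expansion circuit of `≤ 5·2^m` gates (`SIZERelFanIn_subset_SIZE`).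
evasions_known: as in `RelativizedCircuitSize` (gate elimination up to `3.1n`; the relativizing fixed-polynomial bounds for `Σ₂ᵖ`, `ZPP^{NP}`, `S₂ᵖ`; Vinodchandran–Aaronson `PP ⊄ SIZE(n^k)` non-relativizing; algebrization above) [cite: Aaronson2006, abstract and §1.3] [cite: AaronsonWigderson2008, Thm. 5.6]; plus (d) uniform lower bounds by diagonalization [cite: SanthanamWilliams2014, Thms. 1.1 and 1.3] and (a)–(c) above, which are not evasions by technique but regions the barrier never covered.
scope_caveats: the riders (i)–(iii) are theorems of this file over the tree's `SIZERel` / `SIZE` / `PPoly` / `IsTally` / `IsSparseLanguage` and the new bounded-fan-in class `SIZERelFanIn`; "iff they hold" in (i) is literal (`∅` is tally), so tally/sparse positive relativization gives no proof METHOD, only the absence of an obstruction; whether a contrary oracle exists for oracle gates of fan-in between `ω(log n)` and `n` is open (Wilson's needs `≥ 2n + o(n)`; his Thm. 0 lower bound is the only printed result with a query-length parameter) [cite: Wilson1985, Thm. 0 (p. 172) and §4 (p. 180)]; the classes are rendered with `⋃_c SIZE(c·n^k + c)` (robust to the `+1` gate of the simulations); everything else as in `RelativizedCircuitSize` (transcript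 model `PRel`/`NPRel`/`PRelClass`, adequate for language oracles).
status: theorem (established: `RelativizedCircuitSize_holds` and this file) [cite: Wilson1985, Thms. 3.1 and 4] -/
def RelativizedCircuitSizeNarrow : Prop :=
  RelativizedCircuitSize ∧
    (∀ T : Language Bool, IsTally T → ∀ s : ℕ → ℕ, SIZERel T s ⊆ SIZE (fun n => s n + 1)) ∧
    (∀ S : Language Bool, IsSparseLanguage S →
      DeltaTwoRel S ⊆ (⋃ c : ℕ, SIZERel S (fun n => c * n + c)) → NP ⊆ PPoly) ∧
    (∀ (A : Language Bool) (K : ℕ → ℕ) (p : Polynomial ℕ), (∀ n, 2 ^ K n ≤ p.eval n) →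
      NPRel (Oracle.ofLanguage A) ⊆ (⋃ c : ℕ, SIZERelFanIn A K (fun n => c * n + c)) → NP ⊆ PPoly)

/-- The narrowed entry from the barrier fact: the three riders are theorems.
[cite: Wilson1985, Thms. 3.1 and 4] -/
theorem RelativizedCircuitSizeNarrow.of_fact (h : RelativizedCircuitSize) :
    RelativizedCircuitSizeNarrow :=
  ⟨h, fun _ hT s => hT.SIZERel_subset_SIZE s,
    fun _ hS hSl => NP_subset_PPoly_of_sparse_deltaTwo_linear hS hSl,
    fun _ _ p hK h => NP_subset_PPoly_of_fanIn_np_linear p hK h⟩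

/-- **The narrowed entry holds** (from `RelativizedCircuitSize_holds`, Wilson's theorems proved
in the tree, and the riders of this file). [cite: Wilson1985, Thms. 3.1 and 4] -/
theorem RelativizedCircuitSizeNarrow_holds : RelativizedCircuitSizeNarrow :=
  RelativizedCircuitSizeNarrow.of_fact RelativizedCircuitSize_holds

/-- The narrowed entry implies the catalogued one. [cite: Wilson1985, Thms. 3.1 and 4] -/
theorem RelativizedCircuitSizeNarrow.relativizedCircuitSize (h : RelativizedCircuitSizeNarrow) :
    RelativizedCircuitSize :=
  h.1

/-- **Summary of the narrowing** from the barrier fact: (1) no oracle-indexed statement yielding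
superlinear `Δ₂ᵖ` bounds relativizes (the catalogued no-go); (2) but every statement implied by
the superpolynomial-`NP` shape is sparse-relativizing unless `NP ⊆ P/poly`; (3) every statement
implied by the superlinear-`NP` shape is tally-relativizing as soon as `NP ⊄ SIZE(O(n))`; (4) the
oracle of Thm. 3.1 is dense unless `NP ⊆ P/poly`. [cite: Wilson1985, §1.2 (a) p. 170, Thm. 3.1] [cite: Schoning1995, §3–§4 (pp. 525–529)] -/
theorem RelativizedCircuitSizeNarrow.summary (h : RelativizedCircuitSizeNarrow) :
    (∀ Φ : Oracle → Prop,
      (∀ A : Language Bool, Φ (Oracle.ofLanguage A) →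
        ∃ L ∈ DeltaTwoRel A, ∀ c : ℕ, L ∉ SIZERel A (fun n => c * n + c)) →
      ¬ Relativizes Φ) ∧
    (∀ Φ : Oracle → Prop,
      (∀ A : Language Bool, (∃ L ∈ NPRel (Oracle.ofLanguage A), ∀ k c : ℕ,
        L ∉ SIZERel A (fun n => c * n ^ k + c)) → Φ (Oracle.ofLanguage A)) →
      ¬ NP ⊆ PPoly → CRelativizes {S | IsSparseLanguage S} Φ) ∧
    (∀ Φ : Oracle → Prop,
      (∀ A : Language Bool, (∃ L ∈ NPRel (Oracle.ofLanguage A), ∀ c : ℕ,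
        L ∉ SIZERel A (fun n => c * n + c)) → Φ (Oracle.ofLanguage A)) →
      (∃ L ∈ NP, ∀ c : ℕ, L ∉ SIZE (fun n => c * n + c)) → CRelativizes {T | IsTally T} Φ) ∧
    (¬ NP ⊆ PPoly → ∃ B : Language Bool,
      DeltaTwoRel B ⊆ (⋃ c : ℕ, SIZERel B (fun n => c * n + c)) ∧ ¬ IsSparseLanguage B) :=
  ⟨fun _ hΦ => h.1.1.not_relativizes_superlinear_deltaTwo hΦ,
    fun _ hΦ hNP => cRelativizes_sparse_of_NP_not_subset_PPoly hΦ hNP,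
    fun _ hΦ hlin => cRelativizes_tally_of_np_superlinear hΦ hlin,
    fun hNP => (h.1.1.oracle_dense hNP).1⟩

/-- The summary, unconditionally. [cite: Wilson1985, §1.2 (a) p. 170, Thm. 3.1] [cite: Schoning1995, §3–§4 (pp. 525–529)] -/
theorem relativizedCircuitSizeNarrow_summary_holds :
    (∀ Φ : Oracle → Prop,
      (∀ A : Language Bool, Φ (Oracle.ofLanguage A) →
        ∃ L ∈ DeltaTwoRel A, ∀ c : ℕ, L ∉ SIZERel A (fun n => c * n + c)) →
      ¬ Relativizes Φ) ∧
    (∀ Φ : Oracle → Prop,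
      (∀ A : Language Bool, (∃ L ∈ NPRel (Oracle.ofLanguage A), ∀ k c : ℕ,
        L ∉ SIZERel A (fun n => c * n ^ k + c)) → Φ (Oracle.ofLanguage A)) →
      ¬ NP ⊆ PPoly → CRelativizes {S | IsSparseLanguage S} Φ) ∧
    (∀ Φ : Oracle → Prop,
      (∀ A : Language Bool, (∃ L ∈ NPRel (Oracle.ofLanguage A), ∀ c : ℕ,
        L ∉ SIZERel A (fun n => c * n + c)) → Φ (Oracle.ofLanguage A)) →
      (∃ L ∈ NP, ∀ c : ℕ, L ∉ SIZE (fun n => c * n + c)) → CRelativizes {T | IsTally T} Φ) ∧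
    (¬ NP ⊆ PPoly → ∃ B : Language Bool,
      DeltaTwoRel B ⊆ (⋃ c : ℕ, SIZERel B (fun n => c * n + c)) ∧ ¬ IsSparseLanguage B) :=
  RelativizedCircuitSizeNarrow_holds.summary

/-- **Wilson's oracle is dense, unconditionally in the fact** (from `Wilson1985_thm_3_1_holds`):
unless `NP ⊆ P/poly` there is a non-sparse `B` with `Δ₂^{P,B}` linear-size and no sparse one.
[cite: Wilson1985, Thm. 3.1 (p. 175) and Lemma 2 (pp. 173–175)] -/
theorem wilson_oracle_dense (hNP : ¬ NP ⊆ PPoly) :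
    (∃ B : Language Bool, DeltaTwoRel B ⊆ (⋃ c : ℕ, SIZERel B (fun n => c * n + c)) ∧
        ¬ IsSparseLanguage B) ∧
      ∀ S : Language Bool, IsSparseLanguage S →
        ¬ DeltaTwoRel S ⊆ ⋃ c : ℕ, SIZERel S (fun n => c * n + c) :=
  Wilson1985_thm_3_1_holds.oracle_dense hNP

end Literature.Barriers.PneNP
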